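import Mathlib
import Summits.Ventures.HodgeRepro.Tier4.Line1.FiniteLevelIsolation
import Summits.Ventures.HodgeRepro.Tier4.Line1.RationalPoints
import Summits.Ventures.HodgeRepro.Tier4.Line1.RtfSpectralStep
import Summits.Ventures.HodgeRepro.Tier4.Line4.L1ClassV3
import Summits.Ventures.HodgeRepro.Tier4.Line4.ArchDistBounds

/-!
# Tier4/Line4/OrbitDecay — C-L4-ORBDECAY (S3): the orbital terms of a decaying test decay in the orbit size

Blind re-derivation cell `pub-hodge-repro`, Tier 4 «PROVE THE STEP» (README §9–§10), LINE L4, cut C-L4-ORBDECAY = (S3) of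
C-L4-TAIL (plan-4 g4 S14998 over `orbitDist`; lead (R-24) S15009; statement line S15025), seat t4-L2-p3 (gen 4).

* `archDist_ofInfPart`: the archimedean distance ignores the finite part;
* **`exists_norm_conv_le_exp_of_decay`** — (1) the level test `(finf ⊗ ffin) ⋆ f₂` inherits the weight-3 decay of the
  archimedean coefficient: `‖conv (prodFn finf ffin) f₂ (x)‖ ≤ C₀ e^{−3 archDist x}` with
  `C₀ = C M₁ M₂ e^{3 c_K} μ(K⁻¹)` for `‖ffin‖ ≤ M₁`, `‖f₂‖ ≤ M₂`, `tsupport f₂ ⊆ K` compact (the integrand lives on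
  `x K⁻¹`, where `archDist x ≤ archDist h + c_K` by subadditivity; `norm_integral_le_of_norm_le` against the indicator);
* **`norm_orbital_le_exp_of_decay`** — (2) the orbital integral of a function with `‖F x‖ ≤ C₀ e^{−3 archDist x}` is
  `≤ C e^{−3 d(o)}` for any orbit size `d` BELOW the orbit (`d o ≤ archDist γ` for `γ ∈ o` — `orbitDist_le`), when the
  orbit sums have at most `Fc` non-zero terms on `D_T × D_T′`: each term `≤ C₀ e^{3c} e^{−3 archDist γ}` (the compact-shift
  bound `archDist_le_conj_add` of ArchDistBounds), `C = μ_T(D_T) μ_T′(D_T′) Fc C₀ e^{3c}`;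
* **`exists_norm_orbital_le_exp_of_decay`** — (3) THE DISPLAY (S3) for the level family `(finf ⊗ ffin N) ⋆ f₂ N`
  under level-uniform bounds: exactly the `hdecay` of L1-p4's `Setting.exists_J_ne_zero_of_support_count`
  (TailAssemblySupport p700783) at `β + δ = 3`, for `d := orbitDist S` (`hd` = `orbitDist_le`) and the count binder
  `hcount` = C-L4-TORUSFIN (x2 g4).

Mathlib + the landed L1 / L4 modules only; no printed input; nothing here asserts anything about the truth of (P);
HC_CM is NOT proved by anyone in this repository.
-/

set_option autoImplicit false

noncomputable section

namespace Summit.Ventures.HodgeRepro.Tier4.Line4.L1Class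

open MeasureTheory Topology Filter NumberField Summit.Ventures.HodgeRepro.Tier4.Common
  Summit.Ventures.HodgeRepro.Tier4.Line1 Summit.Ventures.HodgeRepro.Tier4.Line1.RTF
open scoped Pointwise ComplexConjugate

variable {k : Type} [Field k] [NumberField k] (W : PlaneData k) [MeasurableSpace (GA W)] [BorelSpace (GA W)]

/-! ## 1. The archimedean distance ignores the finite part -/

omit [MeasurableSpace (GA W)] [BorelSpace (GA W)] in
/-- the archimedean size of `ofInfPart x` is that of `x` (the `w`-component of an entry is read from the infinite
part) -/
theorem archSizeAt_ofInfPart (w : InfinitePlace k) (x : GA W) :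
    archSizeAt W w (GA.ofInfPart W x) = archSizeAt W w x := rfl

omit [MeasurableSpace (GA W)] [BorelSpace (GA W)] in
/-- `archDist (ofInfPart x) = archDist x` -/
theorem archDist_ofInfPart (x : GA W) : archDist W (GA.ofInfPart W x) = archDist W x := by
  simp only [archDist, archSizeAt_ofInfPart]

omit [MeasurableSpace (GA W)] [BorelSpace (GA W)] in
/-- a decaying coefficient is bounded by a NON-NEGATIVE constant times `e^{−3 archDist}` -/
theorem HasDecay3.exists_nonneg {finf : GA W → ℂ} (h : HasDecay3 W finf) :
    ∃ C : ℝ, 0 ≤ C ∧ ∀ x, ‖finf x‖ ≤ C * Real.exp (-(3 * archDist W x)) := by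
  obtain ⟨C, hC⟩ := h
  refine ⟨max C 0, le_max_right _ _, fun x => (hC x).trans ?_⟩
  exact mul_le_mul_of_nonneg_right (le_max_left _ _) (Real.exp_pos _).le

/-! ## 2. The level test decays: `(finf ⊗ ffin) ⋆ f₂` -/

/-- **(1) the decay of the level test, explicit constant**: for `‖finf x‖ ≤ C e^{−3 archDist x}`, `‖ffin‖ ≤ M₁`,
`‖f₂‖ ≤ M₂`, `tsupport f₂ ⊆ K` with `archDist ≤ c_K` on the compact `K`:
`‖((finf ⊗ ffin) ⋆ f₂)(x)‖ ≤ C M₁ M₂ e^{3 c_K} μ(K⁻¹) e^{−3 archDist x}` — the integrand lives on `x K⁻¹`, where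
`archDist x ≤ archDist h + c_K` by subadditivity; `norm_integral_le_of_norm_le` against the indicator of `x K⁻¹` (no
integrability of the convolution integrand is needed). -/
theorem norm_conv_le_exp_of_decay (S : Setting (GA W)) {finf ffin f₂ : GA W → ℂ} {C : ℝ} (hC0 : 0 ≤ C)
    (hC : ∀ x, ‖finf x‖ ≤ C * Real.exp (-(3 * archDist W x))) {M₁ M₂ : ℝ} (hffin : ∀ x, ‖ffin x‖ ≤ M₁)
    (hf₂ : ∀ x, ‖f₂ x‖ ≤ M₂) {K : Set (GA W)} (hK : IsCompact K) (hsupp : tsupport f₂ ⊆ K) {cK : ℝ}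
    (hcK : ∀ y ∈ K, archDist W y ≤ cK) (x : GA W) :
    ‖S.conv (prodFn W finf ffin) f₂ x‖ ≤
      C * M₁ * M₂ * Real.exp (3 * cK) * S.μ.real K⁻¹ * Real.exp (-(3 * archDist W x)) := by
  haveI := S.haar
  haveI := t2Space_GA W
  have hM₁ : 0 ≤ M₁ := (norm_nonneg _).trans (hffin 1)
  have hM₂ : 0 ≤ M₂ := (norm_nonneg _).trans (hf₂ 1)
  -- the pointwise bound of the integrand by the indicator of `x • K⁻¹`
  have hKinv : IsCompact K⁻¹ := hK.inv
  have hmeas : MeasurableSet (x • K⁻¹) := (hKinv.smul x).isClosed.measurableSet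
  have hfin : S.μ (x • K⁻¹) ≠ ⊤ := (hKinv.smul x).measure_lt_top.ne
  set D : ℝ := C * M₁ * M₂ * Real.exp (3 * cK) * Real.exp (-(3 * archDist W x)) with hD
  have hbound : ∀ h : GA W, ‖prodFn W finf ffin h * f₂ (h⁻¹ * x)‖ ≤ (x • K⁻¹).indicator (fun _ => D) h := by
    intro h
    by_cases hh : h ∈ x • K⁻¹
    · rw [Set.indicator_of_mem hh]
      -- `h = x * y` with `y ∈ K⁻¹`, so `archDist x ≤ archDist h + c_K`
      obtain ⟨y, hy, rfl⟩ := hh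
      have hy' : y⁻¹ ∈ K := Set.inv_mem_inv.1 (by simpa using hy)
      have h1 : archDist W x ≤ archDist W (x • y) + cK := by
        have e : x = (x • y) * y⁻¹ := by simp [smul_eq_mul]
        calc archDist W x = archDist W ((x • y) * y⁻¹) := by rw [← e]
          _ ≤ archDist W (x • y) + archDist W y⁻¹ := archDist_mul_le W _ _
          _ ≤ archDist W (x • y) + cK := by linarith [hcK y⁻¹ hy']
      have h2 : ‖finf (GA.ofInfPart W (x • y))‖ ≤ C * Real.exp (3 * cK) * Real.exp (-(3 * archDist W x)) := by
        calc ‖finf (GA.ofInfPart W (x • y))‖ ≤ C * Real.exp (-(3 * archDist W (GA.ofInfPart W (x • y)))) := hC _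
          _ = C * Real.exp (-(3 * archDist W (x • y))) := by rw [archDist_ofInfPart]
          _ ≤ C * (Real.exp (3 * cK) * Real.exp (-(3 * archDist W x))) := by
              refine mul_le_mul_of_nonneg_left ?_ hC0
              rw [← Real.exp_add]
              exact Real.exp_le_exp.2 (by linarith)
          _ = C * Real.exp (3 * cK) * Real.exp (-(3 * archDist W x)) := by ring
      calc ‖prodFn W finf ffin (x • y) * f₂ ((x • y)⁻¹ * x)‖
          = ‖finf (GA.ofInfPart W (x • y))‖ * ‖ffin (GA.ofFinPart W (x • y))‖ * ‖f₂ ((x • y)⁻¹ * x)‖ := by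
            simp only [prodFn, norm_mul]
        _ ≤ (C * Real.exp (3 * cK) * Real.exp (-(3 * archDist W x))) * M₁ * M₂ := by
            gcongr
            · exact hffin _
            · exact hf₂ _
        _ = D := by rw [hD]; ring
    · rw [Set.indicator_of_notMem hh]
      -- outside `x • K⁻¹` the second factor vanishes
      have h0 : f₂ (h⁻¹ * x) = 0 := by
        by_contra hne
        apply hh
        have hmem : h⁻¹ * x ∈ K := hsupp (subset_tsupport _ hne)
        refine ⟨(h⁻¹ * x)⁻¹, Set.inv_mem_inv.2 hmem, ?_⟩
        simp [smul_eq_mul]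
      simp [h0]
  calc ‖S.conv (prodFn W finf ffin) f₂ x‖
      = ‖∫ h, prodFn W finf ffin h * f₂ (h⁻¹ * x) ∂S.μ‖ := rfl
    _ ≤ ∫ h, (x • K⁻¹).indicator (fun _ => D) h ∂S.μ :=
        norm_integral_le_of_norm_le ((integrable_indicator_iff hmeas).2 (integrableOn_const hfin))
          (Eventually.of_forall hbound)
    _ = S.μ.real (x • K⁻¹) * D := by
        rw [integral_indicator_const _ hmeas, smul_eq_mul]
    _ = S.μ.real K⁻¹ * D := by rw [measureReal_def, measureReal_def, measure_smul]
    _ = C * M₁ * M₂ * Real.exp (3 * cK) * S.μ.real K⁻¹ * Real.exp (-(3 * archDist W x)) := by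
        rw [hD]; ring

/-- **(1) the decay of the level test**: `‖((finf ⊗ ffin) ⋆ f₂)(x)‖ ≤ C₀ e^{−3 archDist x}` for `finf` of weight-3 decay,
`‖ffin‖ ≤ M₁`, `‖f₂‖ ≤ M₂`, `tsupport f₂ ⊆ K` compact. -/
theorem exists_norm_conv_le_exp_of_decay (S : Setting (GA W)) {finf ffin f₂ : GA W → ℂ} (hdec : HasDecay3 W finf)
    {M₁ M₂ : ℝ} (hffin : ∀ x, ‖ffin x‖ ≤ M₁) (hf₂ : ∀ x, ‖f₂ x‖ ≤ M₂) {K : Set (GA W)} (hK : IsCompact K)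
    (hsupp : tsupport f₂ ⊆ K) :
    ∃ C₀ : ℝ, 0 ≤ C₀ ∧ ∀ x, ‖S.conv (prodFn W finf ffin) f₂ x‖ ≤ C₀ * Real.exp (-(3 * archDist W x)) := by
  obtain ⟨C, hC0, hC⟩ := hdec.exists_nonneg W
  obtain ⟨cK, hcK⟩ := exists_archDist_le_of_isCompact W K hK
  have hM₁ : 0 ≤ M₁ := (norm_nonneg _).trans (hffin 1)
  have hM₂ : 0 ≤ M₂ := (norm_nonneg _).trans (hf₂ 1)
  refine ⟨C * M₁ * M₂ * Real.exp (3 * max cK 0) * S.μ.real K⁻¹, by positivity, fun x => ?_⟩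
  exact norm_conv_le_exp_of_decay W S hC0 hC hffin hf₂ hK hsupp
    (fun y hy => (hcK y hy).trans (le_max_left _ _)) x

/-! ## 3. The orbital integral of a decaying function -/

omit [BorelSpace (GA W)] in
/-- **(2) the orbital integral of a decaying function decays in the orbit size, explicit constant**: for
`‖F x‖ ≤ C₀ e^{−3 archDist x}`, an orbit size `d` with `d o ≤ archDist γ` on the orbit (`orbitDist_le`), the compact-shift
constant `c` of `closure D_T`, `closure D_T′` (`archDist γ ≤ archDist (t⁻¹ γ t′) + c`), and at most `Fc` non-zero terms
of the orbit sum at every `(t, t′) ∈ D_T × D_T′`: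
`‖orbital χ χ′ o F‖ ≤ μ_T(D_T) μ_T′(D_T′) Fc C₀ e^{3c} e^{−3 d(o)}`. -/
theorem norm_orbital_le_exp_of_decay (S : Setting (GA W)) {χ : S.T → ℂ} {χ' : S.T' → ℂ} (hu : ∀ a, ‖χ a‖ = 1)
    (hu' : ∀ a, ‖χ' a‖ = 1) {F : GA W → ℂ} {C₀ : ℝ} (hC₀ : 0 ≤ C₀)
    (hF : ∀ x, ‖F x‖ ≤ C₀ * Real.exp (-(3 * archDist W x))) (d : S.Orbit → ℝ)
    (hd : ∀ (o : S.Orbit) (γ : S.Gk), S.orbitOf γ = o → d o ≤ archDist W (γ : GA W)) {c : ℝ}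
    (hc : ∀ (t : S.T) (t' : S.T'), t ∈ S.DT → t' ∈ S.DT' → ∀ g : GA W,
      archDist W g ≤ archDist W ((t : GA W)⁻¹ * g * t') + c) {Fc : ℕ} (o : S.Orbit)
    (hcount : ∀ (t : S.T) (t' : S.T'), t ∈ S.DT → t' ∈ S.DT' →
      {γ : {γ : S.Gk // S.orbitOf γ = o} | F ((t : GA W)⁻¹ * γ.1 * t') ≠ 0}.Finite ∧
        {γ : {γ : S.Gk // S.orbitOf γ = o} | F ((t : GA W)⁻¹ * γ.1 * t') ≠ 0}.ncard ≤ Fc) :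
    ‖S.orbital χ χ' o F‖ ≤
      S.μT.real S.DT * S.μT'.real S.DT' * (Fc * (C₀ * Real.exp (3 * c))) * Real.exp (-(3 * d o)) := by
  haveI := S.haarT
  haveI := S.haarT'
  -- the pointwise bound of the partial kernel on `D_T × D_T′`
  have hker : ∀ (t : S.T) (t' : S.T'), t ∈ S.DT → t' ∈ S.DT' →
      ‖S.partialKernel o F t t'‖ ≤ Fc * (C₀ * Real.exp (3 * c)) * Real.exp (-(3 * d o)) := by
    intro t t' ht ht'
    obtain ⟨hfin, hcard⟩ := hcount t t' ht ht'
    -- each non-zero term is `≤ C₀ e^{3c} e^{−3 d o}`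
    have hterm : ∀ γ : {γ : S.Gk // S.orbitOf γ = o},
        ‖F ((t : GA W)⁻¹ * γ.1 * t')‖ ≤ C₀ * Real.exp (3 * c) * Real.exp (-(3 * d o)) := by
      intro γ
      have h1 := hc t t' ht ht' (γ.1 : GA W)
      have h2 : d o ≤ archDist W (γ.1 : GA W) := hd o γ.1 γ.2
      calc ‖F ((t : GA W)⁻¹ * γ.1 * t')‖ ≤ C₀ * Real.exp (-(3 * archDist W ((t : GA W)⁻¹ * γ.1 * t'))) := hF _
        _ ≤ C₀ * (Real.exp (3 * c) * Real.exp (-(3 * d o))) := by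
            refine mul_le_mul_of_nonneg_left ?_ hC₀
            rw [← Real.exp_add]
            exact Real.exp_le_exp.2 (by linarith)
        _ = C₀ * Real.exp (3 * c) * Real.exp (-(3 * d o)) := by ring
    -- the partial kernel is the finite sum of its non-zero terms
    unfold Setting.partialKernel
    rw [tsum_eq_sum (s := hfin.toFinset) (fun γ hγ => by
      by_contra hne
      exact hγ (hfin.mem_toFinset.2 hne))]
    calc ‖∑ γ ∈ hfin.toFinset, F ((t : GA W)⁻¹ * γ.1 * t')‖
        ≤ ∑ γ ∈ hfin.toFinset, ‖F ((t : GA W)⁻¹ * γ.1 * t')‖ := norm_sum_le _ _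
      _ ≤ ∑ _γ ∈ hfin.toFinset, C₀ * Real.exp (3 * c) * Real.exp (-(3 * d o)) :=
          Finset.sum_le_sum fun γ _ => hterm γ
      _ = (hfin.toFinset.card : ℝ) * (C₀ * Real.exp (3 * c) * Real.exp (-(3 * d o))) := by
          rw [Finset.sum_const, nsmul_eq_mul]
      _ ≤ (Fc : ℝ) * (C₀ * Real.exp (3 * c) * Real.exp (-(3 * d o))) := by
          gcongr
          rw [← Set.ncard_eq_toFinset_card _ hfin]
          exact_mod_cast hcard
      _ = Fc * (C₀ * Real.exp (3 * c)) * Real.exp (-(3 * d o)) := by ring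
  -- integrate over `D_T′`, then over `D_T` (`|χ| = |χ′| = 1`)
  have hDT : S.μT S.DT < ⊤ := lt_top_iff_ne_top.2 S.measure_DT_ne_top
  have hDT' : S.μT' S.DT' < ⊤ := lt_top_iff_ne_top.2 S.measure_DT'_ne_top
  have hinner : ∀ t : S.T, t ∈ S.DT →
      ‖∫ t' in S.DT', S.partialKernel o F t t' * χ t * conj (χ' t') ∂S.μT'‖ ≤
        (Fc * (C₀ * Real.exp (3 * c)) * Real.exp (-(3 * d o))) * S.μT'.real S.DT' := by
    intro t ht
    refine norm_setIntegral_le_of_norm_le_const hDT' fun t' ht' => ?_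
    rw [norm_mul, norm_mul, hu, RCLike.norm_conj, hu', mul_one, mul_one]
    exact hker t t' ht ht'
  unfold Setting.orbital
  calc ‖∫ t in S.DT, ∫ t' in S.DT', S.partialKernel o F t t' * χ t * conj (χ' t') ∂S.μT' ∂S.μT‖
      ≤ ((Fc * (C₀ * Real.exp (3 * c)) * Real.exp (-(3 * d o))) * S.μT'.real S.DT') * S.μT.real S.DT :=
        norm_setIntegral_le_of_norm_le_const hDT fun t ht => hinner t ht
    _ = S.μT.real S.DT * S.μT'.real S.DT' * (Fc * (C₀ * Real.exp (3 * c))) * Real.exp (-(3 * d o)) := by ring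

omit [BorelSpace (GA W)] in
/-- the compact-shift constant of the fundamental domains: `archDist γ ≤ archDist (t⁻¹ γ t′) + c` for `t ∈ D_T`,
`t′ ∈ D_T′` (ArchDistBounds' `archDist_le_conj_add` on the compact closures). -/
theorem exists_archDist_le_conj_DT_add (S : Setting (GA W)) :
    ∃ c : ℝ, 0 ≤ c ∧ ∀ (t : S.T) (t' : S.T'), t ∈ S.DT → t' ∈ S.DT' → ∀ g : GA W,
      archDist W g ≤ archDist W ((t : GA W)⁻¹ * g * t') + c := by
  obtain ⟨c, hc⟩ := archDist_le_conj_add W _ _ S.isCompact_image_closure_DT S.isCompact_image_closure_DT'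
  refine ⟨max c 0, le_max_right _ _, fun t t' ht ht' g => ?_⟩
  have := hc (t : GA W) ⟨t, subset_closure ht, rfl⟩ (t' : GA W) ⟨t', subset_closure ht', rfl⟩ g
  linarith [le_max_left c 0]

/-! ## 4. The display (S3): the level family -/

/-- **C-L4-ORBDECAY — (S3) of C-L4-TAIL**: for a decaying archimedean coefficient `finf` and a level family with
LEVEL-UNIFORM bounds (`‖ffin N‖ ≤ M₁`, `‖f₂ N‖ ≤ M₂`, `tsupport (f₂ N) ⊆ K` compact), an orbit size `d` below the orbit
(`orbitDist_le`), and at most `Fc` non-zero orbit-sum terms on `D_T × D_T′` uniformly in the level and the orbit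
(C-L4-TORUSFIN), the orbital terms of `(finf ⊗ ffin N) ⋆ f₂ N` satisfy `‖orbital χ χ′ o (f N)‖ ≤ C e^{−3 d(o)}` with `C`
independent of `N` and `o` — the `hdecay` of `Setting.exists_J_ne_zero_of_support_count` at `β + δ = 3`. -/
theorem exists_norm_orbital_le_exp_of_decay (S : Setting (GA W)) {χ : S.T → ℂ} {χ' : S.T' → ℂ}
    (hu : ∀ a, ‖χ a‖ = 1) (hu' : ∀ a, ‖χ' a‖ = 1) {finf : GA W → ℂ} (hdec : HasDecay3 W finf)
    {ffin f₂ : ℕ → GA W → ℂ} {M₁ M₂ : ℝ} (hffin : ∀ N x, ‖ffin N x‖ ≤ M₁) (hf₂ : ∀ N x, ‖f₂ N x‖ ≤ M₂)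
    {K : Set (GA W)} (hK : IsCompact K) (hsupp : ∀ N, tsupport (f₂ N) ⊆ K) (d : S.Orbit → ℝ)
    (hd : ∀ (o : S.Orbit) (γ : S.Gk), S.orbitOf γ = o → d o ≤ archDist W (γ : GA W)) {Fc : ℕ}
    (hcount : ∀ (N : ℕ) (o : S.Orbit) (t : S.T) (t' : S.T'), t ∈ S.DT → t' ∈ S.DT' →
      {γ : {γ : S.Gk // S.orbitOf γ = o} |
        S.conv (prodFn W finf (ffin N)) (f₂ N) ((t : GA W)⁻¹ * γ.1 * t') ≠ 0}.Finite ∧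
        {γ : {γ : S.Gk // S.orbitOf γ = o} |
          S.conv (prodFn W finf (ffin N)) (f₂ N) ((t : GA W)⁻¹ * γ.1 * t') ≠ 0}.ncard ≤ Fc) :
    ∃ C : ℝ, 0 ≤ C ∧ ∀ (N : ℕ) (o : S.Orbit),
      ‖S.orbital χ χ' o (S.conv (prodFn W finf (ffin N)) (f₂ N))‖ ≤ C * Real.exp (-(3 * d o)) := by
  obtain ⟨C, hC0, hC⟩ := hdec.exists_nonneg W
  obtain ⟨cK, hcK⟩ := exists_archDist_le_of_isCompact W K hK
  obtain ⟨c, hc0, hc⟩ := exists_archDist_le_conj_DT_add W S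
  have hM₁ : 0 ≤ M₁ := (norm_nonneg _).trans (hffin 0 1)
  have hM₂ : 0 ≤ M₂ := (norm_nonneg _).trans (hf₂ 0 1)
  set C₀ : ℝ := C * M₁ * M₂ * Real.exp (3 * max cK 0) * S.μ.real K⁻¹ with hC₀
  have hC₀0 : 0 ≤ C₀ := by positivity
  refine ⟨S.μT.real S.DT * S.μT'.real S.DT' * (Fc * (C₀ * Real.exp (3 * c))), by positivity, fun N o => ?_⟩
  exact norm_orbital_le_exp_of_decay W S hu hu' hC₀0
    (fun x => norm_conv_le_exp_of_decay W S hC0 hC (hffin N) (hf₂ N) hK (hsupp N)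
      (fun y hy => (hcK y hy).trans (le_max_left _ _)) x)
    d hd hc o (hcount N o)

end Summit.Ventures.HodgeRepro.Tier4.Line4.L1Class

end
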